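import Literature.AlgebraicGeometry.HodgeTheory.QuaternionicQuarticDeckChart
import Literature.AlgebraicGeometry.Motives.HypersurfaceChartAlgebra
import HarnessLib

/-!
# The chart map `θ : (R[x]_{(x₂·H̃)})₀ ↠ DeckRing`: the deck chart as a closed subscheme of the `Proj`-chart `D₊(x₂ H̃) ⊆ ℙ³`

Layer `Literature/AlgebraicGeometry/HodgeTheory`. Definitions (`branchForm`, `chartToDeck`, `awayToDeck`) + proved API; no
named fact. Written by the prover seat `hodge-nonav-19716-p2` (g13, cell `hodge-nonav`) as the algebraic part of brick
**M1-1 «CHART-IN-COVER»** of prover-Bx's programme M1 (memo `PROGRAMME-M1-Bx-g19.md` §2; route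
`HodgeConjecture/Q8SymplecticPowers`, crux K1Q, stmt-HodgeConjecture-24190): the explicit étale chart
`DeckRing a = R[u₀,u₁,w,w₁,w₂,v]/(r₁,…,r₇)` of the normalised quaternionic quartic (prover-Bx, `QuaternionicQuarticDeckChart`)
receives a SURJECTION from the degree-zero localisation `(R[x₀,…,x₃]_{(x₂·H̃)})₀ = R[y₀,y₁,y₂][1/h]` — the coordinate ring
of the affine chart `D₊(x₂·H̃)` of `ℙ³_R` — killing the chart equation of the quaternionic quartic; i.e.
`Spec DeckRing ↪ D₊(x₂ H̃)` is a closed subscheme supported inside `V₊(Q) ∩ D₊(x₂ H̃)`.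

* `branchForm a = H̃ = c·(σc)·(x₀ − x₁)·ψ ∈ R[x₀,…,x₃]` (homogeneous of degree `e + 2` for `e ≥ 1`; its dehomogenisation
  at `x₂ = 1` is the chart's `hU a`);
* `chartToDeck a = θ₀ : R[y₀,y₁,y₂] →ₐ[R] DeckRing a`, `(y₀,y₁,y₂) = (x₀,x₁,x₃)/x₂ ↦ (u₀,u₁,w)`; its values on dehomogenised
  forms (`chartToDeck_dehomogenize_rename`, `…_X_last`, `…_X_two`, `…_branchForm`), and
  **`chartToDeck_dehomogenize_quarticFormR`**: `θ₀(Q(y₀,y₁,1,y₂)) = [w⁴ − g] = 0` (certificate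
  `w⁴ − g = r₂·(w² + w₁ σc α ψ) + (σc α ψ)²·r₁`, `X_two_pow_four_sub_gU_mem`); `isUnit_mk_hU` (`r₇`), and the
  identities `mk_X_three_eq` (`w₁ = c v w²`: `r₂, r₇`), `mk_X_four_eq` (`w₂ = c α ψ v w w₁`: `r₄, r₇`);
* **`awayToDeck a he = θ : (R[x]_{(x₂ H̃)})₀ →+* DeckRing a`** — the extension of `θ₀` along the chart algebra
  `SmoothHypersurface.chartMap` / `isLocalization_chartMap` (`(R[x]_{(x₂H̃)})₀ = R[y][1/h(y)]`, `θ₀(h)` a unit),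
  `awayToDeck_chartMap`, `awayToDeck_awayMap_isLocalizationElem`, **`awayToDeck_isLocalizationElem_quarticFormR`**
  (`θ(Q/x₂^{2e+4}) = 0`), **`awayToDeck_surjective`**, `awayToDeck_comp_algebraMap` (`R`-linear),
  `specMap_awayToDeck_comp_specMap_algebraMap` (over `Spec R`), and
  **`range_specMap_awayToDeck_subset`**: the image of `Spec θ` lies in `awayι⁻¹ V₊(Q)`.

The reverse inclusion `awayι⁻¹ V₊(Q) ⊆ image (Spec θ)` (⟸ `ker θ ⊆ √(Q/x₂^{2e+4})`, i.e. the dictionary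
`DeckRing ≅ (R[u][w]/(w⁴ − g))[1/h]`, prover-Bx's M1-0a′) and the reducedness of `DeckRing` are NOT proved here; with
them, `Motives.ProjSubscheme.exists_isOpenImmersion_subscheme_of_surjective` makes `Spec DeckRing` an open piece of the
reduced cover `Q8Family.cover e` (file `QuaternionicQuarticDeckChartInCover`). Honest scope: explicit commutative algebra;
nothing here bears on HC.

## References

* [Hartshorne1977] R. Hartshorne, Algebraic Geometry (1977): I §2 (grading), II Prop. 2.5 (b) (`D₊(f) ≅ Spec A_{(f)}`).
* [Kollar2007] J. Kollár, Lectures on Resolution of Singularities (2007), §3.3 (the family's equations).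
-/

noncomputable section

open CategoryTheory AlgebraicGeometry MvPolynomial HomogeneousLocalization
open Literature.AlgebraicGeometry.Motives Literature.AlgebraicGeometry.Motives.UniversalHypersurface

namespace Literature.AlgebraicGeometry.HodgeTheory.Q8Family

universe v

attribute [local instance] MvPolynomial.gradedAlgebra

section ChartMap

variable {R : Type v} [CommRing R] {e : ℕ} (a : CIdx e → R)

/-- **The branch form** `H̃ = c·(σc)·(x₀ − x₁)·ψ ∈ R[x₀, …, x₃]` (no `x₃`): its dehomogenisation at `x₂ = 1` is the
chart's `h = c (σc) α ψ` (`hU`). [cite: Kollar2007, §3.3] -/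
def branchForm : MvPolynomial (Fin 4) R :=
  rename Fin.castSucc (cOfR a * rename (Equiv.swap (0 : Fin 3) 1) (cOfR a) * (X 0 - X 1) * ψOfR a)

/-- `H̃` is homogeneous of degree `e + 2` (`e ≥ 1`). [cite: Hartshorne1977, I §2 (p. 9, the grading of S = k[x₀,…,xₙ])] -/
theorem isHomogeneous_branchForm (he : 1 ≤ e) : (branchForm a).IsHomogeneous (e + 2) := by
  have hc := isHomogeneous_cOfR a
  have h01 : (X 0 - X 1 : MvPolynomial (Fin 3) R).IsHomogeneous 1 := (isHomogeneous_X R 0).sub (isHomogeneous_X R 1)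
  have := ((hc.mul (hc.rename_isHomogeneous (f := Equiv.swap (0 : Fin 3) 1))).mul h01).mul (isHomogeneous_ψOfR a)
  have hdeg : 1 + 1 + 1 + (e - 1) = e + 2 := by omega
  rw [hdeg] at this
  exact this.rename_isHomogeneous

/-- `H̃ ∈ R[x]_{e+2}`. [cite: Hartshorne1977, I §2 (p. 9, the grading of S = k[x₀,…,xₙ])] -/
theorem branchForm_mem (he : 1 ≤ e) : branchForm a ∈ homogeneousSubmodule (Fin (2 + 2)) R (e + 2) :=
  (mem_homogeneousSubmodule _ _).mpr (isHomogeneous_branchForm a he)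

/-- **`θ₀ : R[y₀, y₁, y₂] → DeckRing`, `(y₀, y₁, y₂) ↦ (u₀, u₁, w)`**: the affine coordinates `yⱼ = xⱼ'/x₂` of the chart
`D₊(x₂) ⊆ ℙ³` (`x' = (x₀, x₁, x₃)`) go to the first three generators of the deck chart. [cite: Kollar2007, §3.3] -/
def chartToDeck : MvPolynomial (Fin 3) R →ₐ[R] DeckRing a :=
  aeval ![Ideal.Quotient.mk (deckIdeal a) (X 0), Ideal.Quotient.mk (deckIdeal a) (X 1),
    Ideal.Quotient.mk (deckIdeal a) (X 2)]

/-- `θ₀` on dehomogenised ternary forms: `θ₀(p(y₀, y₁, 1)) = [dehom p]` (`dehom p = p(u₀, u₁, 1)`). [cite: Kollar2007, §3.3] -/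
theorem chartToDeck_dehomogenize_rename (p : MvPolynomial (Fin 3) R) :
    chartToDeck a (ProjectiveSpace.dehomogenize R (2 : Fin 4) (rename Fin.castSucc p)) =
      Ideal.Quotient.mk (deckIdeal a) (dehom p) := by
  change ((chartToDeck a).comp ((ProjectiveSpace.dehomogenize R (2 : Fin 4)).comp (rename Fin.castSucc))) p =
    ((Ideal.Quotient.mkₐ R (deckIdeal a)).comp dehom) p
  congr 1
  refine MvPolynomial.algHom_ext fun i => ?_
  fin_cases i <;>
    simp [chartToDeck, dehom, ProjectiveSpace.dehomogenize, Fin.insertNth_apply_below]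

/-- `θ₀(y₂) = w` (`x₃/x₂ ↦ w`). [cite: Kollar2007, §3.3] -/
theorem chartToDeck_dehomogenize_X_last :
    chartToDeck a (ProjectiveSpace.dehomogenize R (2 : Fin 4) (X (Fin.last 3))) =
      Ideal.Quotient.mk (deckIdeal a) (X 2) := by
  have h3 : (Fin.last 3 : Fin 4) = (2 : Fin 4).succAbove 2 := by decide
  rw [h3, ProjectiveSpace.dehomogenize_X_succAbove]
  simp [chartToDeck]

/-- `θ₀(x₂ := 1) = 1`. [cite: Kollar2007, §3.3] -/
theorem chartToDeck_dehomogenize_X_two :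
    chartToDeck a (ProjectiveSpace.dehomogenize R (2 : Fin 4) (X (Fin.castSucc 2))) = 1 := by
  have h2 : (Fin.castSucc 2 : Fin 4) = 2 := by decide
  rw [h2, ProjectiveSpace.dehomogenize_X_self, map_one]

/-- **`θ₀(H̃(y₀, y₁, 1)) = [h]`.** [cite: Kollar2007, §3.3] -/
theorem chartToDeck_dehomogenize_branchForm :
    chartToDeck a (ProjectiveSpace.dehomogenize R (2 : Fin 4) (branchForm a)) =
      Ideal.Quotient.mk (deckIdeal a) (hU a) := by
  rw [branchForm, chartToDeck_dehomogenize_rename]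
  simp [hU, cU, cU', αU, ψU, dehom]

/-- **`w⁴ − g ∈ (r₁, …, r₇)`**: `w⁴ − g = r₂·(w² + w₁ σc α ψ) + (σc α ψ)²·r₁`. [cite: Kollar2007, §3.3] -/
theorem X_two_pow_four_sub_gU_mem : (X 2 ^ 4 - gU a : MvPolynomial (Fin 6) R) ∈ deckIdeal a := by
  have h : (X 2 ^ 4 - gU a : MvPolynomial (Fin 6) R) =
      (X 2 ^ 2 + X 3 * cU' a * αU * ψU a) * rel a 1 + (cU' a * αU * ψU a) ^ 2 * rel a 0 := by
    simp only [rel, gU]; ring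
  rw [h]
  exact Ideal.add_mem _ (Ideal.mul_mem_left _ _ (rel_mem_deckIdeal a 1)) (Ideal.mul_mem_left _ _ (rel_mem_deckIdeal a 0))

/-- **`θ₀` kills the dehomogenised quaternionic quartic**: `θ₀(Q(y₀, y₁, 1, y₂)) = [w⁴ − g] = 0`. [cite: Kollar2007, §3.3] -/
theorem chartToDeck_dehomogenize_quarticFormR :
    chartToDeck a (ProjectiveSpace.dehomogenize R (2 : Fin 4) (quarticFormR e (cOfR a) (ψOfR a))) = 0 := by
  rw [quarticFormR, map_sub, map_sub, map_mul, map_mul, map_pow, map_pow, map_pow, map_pow,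
    chartToDeck_dehomogenize_X_last, chartToDeck_dehomogenize_X_two, chartToDeck_dehomogenize_rename, one_pow, mul_one]
  rw [← map_pow, ← map_sub, Ideal.Quotient.eq_zero_iff_mem]
  have hg : dehom (cOfR a * rename (Equiv.swap (0 : Fin 3) 1) (cOfR a) ^ 3 * ((X 0 - X 1) * ψOfR a) ^ 2) =
      (gU a : MvPolynomial (Fin 6) R) := by
    simp only [gU, cU, cU', αU, ψU, dehom, map_mul, map_pow, map_sub]
    have h0 : (aeval ![(X 0 : MvPolynomial (Fin 6) R), X 1, 1]) (X 0 : MvPolynomial (Fin 3) R) = X 0 := by simp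
    have h1 : (aeval ![(X 0 : MvPolynomial (Fin 6) R), X 1, 1]) (X 1 : MvPolynomial (Fin 3) R) = X 1 := by simp
    rw [h0, h1]; ring
  rw [hg]
  exact X_two_pow_four_sub_gU_mem a

/-- `[h]·[v] = 1` in the deck chart (`r₇ : v h = 1`). [cite: Kollar2007, §3.3] -/
theorem mk_hU_mul_mk_X_five :
    Ideal.Quotient.mk (deckIdeal a) (hU a) * Ideal.Quotient.mk (deckIdeal a) (X 5) = 1 := by
  rw [← map_mul, ← (Ideal.Quotient.mk (deckIdeal a)).map_one, Ideal.Quotient.eq, mul_comm]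
  exact rel_mem_deckIdeal a 6

/-- `w₁ = c·v·w²` in the deck chart (`X 3 − c X5 X2² = −X3·r₇ − c X5·r₂`). [cite: Kollar2007, §3.3] -/
theorem mk_X_three_eq :
    Ideal.Quotient.mk (deckIdeal a) (X 3) = Ideal.Quotient.mk (deckIdeal a) (cU a * X 5 * X 2 ^ 2) := by
  rw [Ideal.Quotient.eq]
  have h : (X 3 - cU a * X 5 * X 2 ^ 2 : MvPolynomial (Fin 6) R) = (-X 3) * rel a 6 + (-(cU a * X 5)) * rel a 1 := by
    simp only [rel, hU]; ring
  rw [h]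
  exact Ideal.add_mem _ (Ideal.mul_mem_left _ _ (rel_mem_deckIdeal a 6)) (Ideal.mul_mem_left _ _ (rel_mem_deckIdeal a 1))

/-- `w₂ = c α ψ·v·w·w₁` in the deck chart (`X4 − X5 c α ψ X2 X3 = −X4·r₇ − X5 c α ψ·r₄`). [cite: Kollar2007, §3.3] -/
theorem mk_X_four_eq :
    Ideal.Quotient.mk (deckIdeal a) (X 4) =
      Ideal.Quotient.mk (deckIdeal a) (X 5 * cU a * αU * ψU a * X 2 * X 3) := by
  rw [Ideal.Quotient.eq]
  have h : (X 4 - X 5 * cU a * αU * ψU a * X 2 * X 3 : MvPolynomial (Fin 6) R) =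
      (-X 4) * rel a 6 + (-(X 5 * cU a * αU * ψU a)) * rel a 3 := by
    simp only [rel, hU]; ring
  rw [h]
  exact Ideal.add_mem _ (Ideal.mul_mem_left _ _ (rel_mem_deckIdeal a 6)) (Ideal.mul_mem_left _ _ (rel_mem_deckIdeal a 3))

/-- `[h]` is a unit of the deck chart (`r₇ : v h = 1`). [cite: Kollar2007, §3.3] -/
theorem isUnit_mk_hU : IsUnit (Ideal.Quotient.mk (deckIdeal a) (hU a)) := by
  refine IsUnit.of_mul_eq_one (Ideal.Quotient.mk (deckIdeal a) (X 5)) (mk_hU_mul_mk_X_five a)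

end ChartMap

/-! ### The localisation `(R[x]_{(x₂ H̃)})₀ = R[y][1/h] ↠ DeckRing` -/

section AwayMap

variable {R : Type v} [CommRing R] {e : ℕ} (a : CIdx e → R) (he : 1 ≤ e)

attribute [local instance] ProjBaseChange.algebraBase ProjBaseChange.isScalarTower_localization

/-- **`θ : (R[x₀,…,x₃]_{(x₂·H̃)})₀ → DeckRing`**: the chart algebra of `D₊(x₂ H̃) ⊆ ℙ³_R` is the localisation
`R[y₀,y₁,y₂][1/h(y)]` (`SmoothHypersurface.isLocalization_chartMap`), and `θ₀(h)` is a unit, so `θ₀` extends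
(`IsLocalization.Away.lift`). [cite: Hartshorne1977, II Prop. 2.5 (b)] -/
def awayToDeck : Away (homogeneousSubmodule (Fin (2 + 2)) R) (X 2 * branchForm a) →+* DeckRing a :=
  letI := (SmoothHypersurface.chartMap R (2 : Fin 4) (branchForm_mem a he)).toRingHom.toAlgebra
  haveI := SmoothHypersurface.isLocalization_chartMap R (2 : Fin 4) (branchForm_mem a he)
  IsLocalization.Away.lift (ProjectiveSpace.dehomogenize R (2 : Fin 4) (branchForm a))
    (g := (chartToDeck a).toRingHom)
    (by rw [AlgHom.toRingHom_eq_coe, AlgHom.coe_toRingHom, chartToDeck_dehomogenize_branchForm]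
        exact isUnit_mk_hU a)

/-- `θ` extends `θ₀` along the chart map `R[y] → (R[x]_{(x₂ H̃)})₀`. [cite: Hartshorne1977, II Prop. 2.5 (b)] -/
theorem awayToDeck_chartMap (p : MvPolynomial (Fin 3) R) :
    awayToDeck a he (SmoothHypersurface.chartMap R (2 : Fin 4) (branchForm_mem a he) p) = chartToDeck a p := by
  letI := (SmoothHypersurface.chartMap R (2 : Fin 4) (branchForm_mem a he)).toRingHom.toAlgebra
  haveI := SmoothHypersurface.isLocalization_chartMap R (2 : Fin 4) (branchForm_mem a he)
  exact IsLocalization.Away.lift_eq (ProjectiveSpace.dehomogenize R (2 : Fin 4) (branchForm a)) _ p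

/-- `θ(F/x₂ᵈ · (chart twist)) = θ₀(F(y₀, y₁, 1, y₂))` for a form `F` of degree `d`: the value of `θ` on Mathlib's
`awayMap (Away.isLocalizationElem …)` (`SmoothHypersurface.chartMap_dehomogenize`). [cite: Hartshorne1977, II Prop. 2.5 (b)] -/
theorem awayToDeck_awayMap_isLocalizationElem {d : ℕ} (F : MvPolynomial (Fin 4) R)
    (hF : F ∈ homogeneousSubmodule (Fin (2 + 2)) R d) :
    awayToDeck a he (awayMap _ (branchForm_mem a he) rfl (Away.isLocalizationElem (isHomogeneous_X R (2 : Fin 4)) hF)) =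
      chartToDeck a (ProjectiveSpace.dehomogenize R (2 : Fin 4) F) := by
  rw [← SmoothHypersurface.chartMap_dehomogenize R (2 : Fin 4) (branchForm_mem a he) F hF, awayToDeck_chartMap]

/-- **`θ` kills the chart equation of the quaternionic quartic** `Q/x₂^{2e+4}` (read in the chart `D₊(x₂ H̃)`).
[cite: Kollar2007, §3.3] -/
theorem awayToDeck_isLocalizationElem_quarticFormR
    (hQ : quarticFormR e (cOfR a) (ψOfR a) ∈ homogeneousSubmodule (Fin (2 + 2)) R (2 * e + 4)) :
    awayToDeck a he (awayMap _ (branchForm_mem a he) rfl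
      (Away.isLocalizationElem (isHomogeneous_X R (2 : Fin 4)) hQ)) = 0 := by
  rw [awayToDeck_awayMap_isLocalizationElem, chartToDeck_dehomogenize_quarticFormR]

/-- **`θ` is surjective**: `u₀, u₁, w` are `θ₀(yⱼ)`, `v = θ(1/h)`, `w₁ = c·v·w²` (by `r₂, r₇`), `w₂ = c α ψ·v·w·w₁`
(by `r₄, r₇`). [cite: Kollar2007, §3.3] -/
theorem awayToDeck_surjective : Function.Surjective (awayToDeck a he) := by
  letI := (SmoothHypersurface.chartMap R (2 : Fin 4) (branchForm_mem a he)).toRingHom.toAlgebra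
  haveI := SmoothHypersurface.isLocalization_chartMap R (2 : Fin 4) (branchForm_mem a he)
  -- every dehomogenised ternary form is hit
  have hdh : ∀ p : MvPolynomial (Fin 3) R,
      Ideal.Quotient.mk (deckIdeal a) (dehom p) ∈ (awayToDeck a he).range := fun p =>
    ⟨SmoothHypersurface.chartMap R (2 : Fin 4) (branchForm_mem a he)
        (ProjectiveSpace.dehomogenize R (2 : Fin 4) (rename Fin.castSucc p)),
      by rw [awayToDeck_chartMap, chartToDeck_dehomogenize_rename]⟩
  have h0 : Ideal.Quotient.mk (deckIdeal a) (X 0) ∈ (awayToDeck a he).range := by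
    simpa [dehom] using hdh (X 0)
  have h1 : Ideal.Quotient.mk (deckIdeal a) (X 1) ∈ (awayToDeck a he).range := by
    simpa [dehom] using hdh (X 1)
  have h2 : Ideal.Quotient.mk (deckIdeal a) (X 2) ∈ (awayToDeck a he).range :=
    ⟨SmoothHypersurface.chartMap R (2 : Fin 4) (branchForm_mem a he) (X 2), by
      rw [awayToDeck_chartMap]; simp [chartToDeck]⟩
  -- `v = θ(1/h)`
  have hh : awayToDeck a he (algebraMap _ _ (ProjectiveSpace.dehomogenize R (2 : Fin 4) (branchForm a))) =
      Ideal.Quotient.mk (deckIdeal a) (hU a) := by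
    change awayToDeck a he (SmoothHypersurface.chartMap R (2 : Fin 4) (branchForm_mem a he) _) = _
    rw [awayToDeck_chartMap, chartToDeck_dehomogenize_branchForm]
  have h5 : Ideal.Quotient.mk (deckIdeal a) (X 5) ∈ (awayToDeck a he).range := by
    refine ⟨IsLocalization.Away.invSelf (ProjectiveSpace.dehomogenize R (2 : Fin 4) (branchForm a)), ?_⟩
    refine left_inv_eq_right_inv ?_ (mk_hU_mul_mk_X_five a)
    have hinv : IsLocalization.Away.invSelf (S := Away (homogeneousSubmodule (Fin (2 + 2)) R) (X 2 * branchForm a))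
        (ProjectiveSpace.dehomogenize R (2 : Fin 4) (branchForm a)) *
        algebraMap _ _ (ProjectiveSpace.dehomogenize R (2 : Fin 4) (branchForm a)) = 1 := by
      exact (mul_comm _ _).trans (IsLocalization.Away.mul_invSelf _)
    rw [← hh, ← map_mul, hinv, map_one]
  have hc : Ideal.Quotient.mk (deckIdeal a) (cU a) ∈ (awayToDeck a he).range := hdh _
  have hψ : Ideal.Quotient.mk (deckIdeal a) (ψU a) ∈ (awayToDeck a he).range := hdh _
  have hα : Ideal.Quotient.mk (deckIdeal a) (αU : MvPolynomial (Fin 6) R) ∈ (awayToDeck a he).range := by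
    rw [αU, map_sub]; exact sub_mem h0 h1
  have h3 : Ideal.Quotient.mk (deckIdeal a) (X 3) ∈ (awayToDeck a he).range := by
    rw [mk_X_three_eq, map_mul, map_mul, map_pow]
    exact mul_mem (mul_mem hc h5) (pow_mem h2 2)
  have h4 : Ideal.Quotient.mk (deckIdeal a) (X 4) ∈ (awayToDeck a he).range := by
    rw [mk_X_four_eq, map_mul, map_mul, map_mul, map_mul, map_mul]
    exact mul_mem (mul_mem (mul_mem (mul_mem (mul_mem h5 hc) hα) hψ) h2) h3
  have hX : ∀ i : Fin 6, Ideal.Quotient.mk (deckIdeal a) (X i) ∈ (awayToDeck a he).range := by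
    intro i
    fin_cases i
    · exact h0
    · exact h1
    · exact h2
    · exact h3
    · exact h4
    · exact h5
  -- conclude by induction on polynomials
  rw [← RingHom.range_eq_top, eq_top_iff]
  rintro z -
  obtain ⟨p, rfl⟩ := Ideal.Quotient.mk_surjective z
  induction p using MvPolynomial.induction_on with
  | C r =>
    refine ⟨algebraMap R _ r, ?_⟩
    rw [← (SmoothHypersurface.chartMap R (2 : Fin 4) (branchForm_mem a he)).commutes r, awayToDeck_chartMap,
      AlgHom.commutes]
    rfl
  | add p q hp hq => rw [map_add]; exact add_mem hp hq
  | mul_X p i hp => rw [map_mul]; exact mul_mem hp (hX i)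

end AwayMap

/-! ### `θ` is `A`-linear and its `Spec` lands in the chart `V₊(Q_e) ∩ D₊(x₂ H̃)` -/

section Range

variable {R : Type v} [CommRing R] {e : ℕ} (a : CIdx e → R) (he : 1 ≤ e)

attribute [local instance] ProjBaseChange.algebraBase ProjBaseChange.isScalarTower_localization

/-- `θ` is `R`-linear: `θ ∘ (R → (R[x]_{(x₂ H̃)})₀) = (R → DeckRing)`. [cite: Hartshorne1977, II Prop. 2.5 (b)] -/
theorem awayToDeck_comp_algebraMap :
    (awayToDeck a he).comp (algebraMap R _) = algebraMap R (DeckRing a) := by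
  refine RingHom.ext fun r => ?_
  rw [RingHom.comp_apply, ← (SmoothHypersurface.chartMap R (2 : Fin 4) (branchForm_mem a he)).commutes r,
    awayToDeck_chartMap, AlgHom.commutes]

/-- `Spec θ` followed by `Spec (R[x]_{(x₂H̃)})₀ → Spec R` is the structure morphism of the deck chart.
[cite: Hartshorne1977, II Prop. 2.5 (b)] -/
theorem specMap_awayToDeck_comp_specMap_algebraMap :
    Spec.map (CommRingCat.ofHom (awayToDeck a he)) ≫
        Spec.map (CommRingCat.ofHom (algebraMap R (Away (homogeneousSubmodule (Fin (2 + 2)) R) (X 2 * branchForm a)))) =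
      Spec.map (CommRingCat.ofHom (algebraMap R (DeckRing a))) := by
  rw [← Spec.map_comp, ← CommRingCat.ofHom_comp, awayToDeck_comp_algebraMap]

/-- **The image of `Spec θ : Spec DeckRing ↪ Spec (R[x]_{(x₂ H̃)})₀ = D₊(x₂ H̃)` lies in `V₊(Q) ∩ D₊(x₂ H̃)`** (`Q` the
quaternionic quartic of `a`): the image is `V(ker θ)` and `ker θ ∋ Q/x₂^{2e+4}`
(`awayToDeck_isLocalizationElem_quarticFormR`, `ProjSubscheme.awayι_mul_preimage_zeroLocus`). [cite: Hartshorne1977, II Prop. 2.5 (b)] -/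
theorem range_specMap_awayToDeck_subset
    (hQ : quarticFormR e (cOfR a) (ψOfR a) ∈ homogeneousSubmodule (Fin (2 + 2)) R (2 * e + 4)) :
    Set.range (Spec.map (CommRingCat.ofHom (awayToDeck a he))) ⊆
      Proj.awayι (homogeneousSubmodule (Fin (2 + 2)) R) (X 2 * branchForm a)
          (SetLike.mul_mem_graded (isHomogeneous_X R (2 : Fin 4)) (branchForm_mem a he))
          (Nat.one_pos.trans_le (Nat.le_add_right 1 (e + 2))) ⁻¹'
        ProjectiveSpectrum.zeroLocus (homogeneousSubmodule (Fin (2 + 2)) R) {quarticFormR e (cOfR a) (ψOfR a)} := by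
  rw [ProjSubscheme.awayι_mul_preimage_zeroLocus _ (isHomogeneous_X R (2 : Fin 4)) Nat.one_pos
    (branchForm_mem a he) rfl hQ (by omega)]
  rintro _ ⟨p, rfl⟩
  change PrimeSpectrum.comap (awayToDeck a he) p ∈ PrimeSpectrum.zeroLocus _
  rw [PrimeSpectrum.mem_zeroLocus, Set.singleton_subset_iff, SetLike.mem_coe, PrimeSpectrum.comap_asIdeal,
    Ideal.mem_comap, awayToDeck_isLocalizationElem_quarticFormR a he hQ]
  exact Ideal.zero_mem _

end Range

end Literature.AlgebraicGeometry.HodgeTheory.Q8Family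

end
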